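import Literature.NumberTheory.GaloisRepresentations.HasseNormEtaleInvolution
import Literature.LinearAlgebra.Matrix.HermitianAdjointCartanAlgebra
import HarnessLib

/-!
# Hasse's norm principle for the Cartan algebra of a regular unitary matrix, adelic form — the matrix dress of
# `HasseNormEtaleInvolution` (Rogawski 1990 §3.5, §5.4 «`k(γ₀) = 1`»; Cassels–Fröhlich VII §9.6)

Topic `NumberTheory/GaloisRepresentations`; namespace `Literature.NumberTheory.GaloisRepresentations`.  THEOREMS ONLY (no definition, no
instance, no notation, no named fact; D-0026, net debt 0); universe `Type`.

THE PRINT.  [Rogawski1990, §5.4 p. 72]: `k(γ₀) = |ker(𝔇(T/F) → 𝔇(T/𝐀))| = 1` for the maximal tori of the unitary group — two rational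
elements of a regular stable class which are conjugate ADELICALLY are conjugate RATIONALLY; with the Cartan invariant `c(γ, δ) = g g⋆ ∈ Z(γ)`
(`δ = g⁻¹γg`, `⋆` the `H`-adjoint; [Rogawski1990, §3.5]) this is the statement that a `⋆`-symmetric unit `x ∈ Z(γ)` which is a norm `c c⋆`
from the ADELIC commutant `Z_{M_N(𝔸_L)}(γ ⊗ 1)` is a norm `b b⋆` from `Z(γ) ⊂ M_N(L)` — Hasse's norm theorem
[CasselsFrohlichANT1967, Ch. VII §9.6] for the étale algebra with involution `(L[γ], ⋆)`, which is ★ `exists_mul_apply_eq_of_adelic`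
(`HasseNormEtaleInvolution`).  This file supplies the dictionary between matrices over `𝔸_L` and the abstract adelic algebra `𝔸_F ⊗_F L[γ]`.

* §1 (any `L`-subalgebra `B ≤ M_N(L)`; `Ψ : 𝔸_F ⊗_F B →ₐ[F] M_N(𝔸_L)` ANY algebra map with `Ψ(r ⊗ b) = con(r) · (b ⊗ 1)` — the map is
  built in §2, the lemmas quantify over it): **(G1) `injective_of_apply_tmul`** — `Ψ` is injective (entrywise it is
  `𝔸_F ⊗_F B ↪ 𝔸_F ⊗_F M_N(L) = (𝔸_F ⊗_F L)^{N²} ≅ 𝔸_L^{N²}`: `𝔸_F` is flat over the field `F`, Mathlib `Module.Flat.lTensor_preserves_injective_linearMap`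
  + `TensorProduct.piRight` + ★ `adeleRingTensorAlgEquiv F L` (Cassels–Fröhlich (19.1))); `smul_one_mem_range` (`𝔸_L · 1 ⊆ range Ψ`:
  `𝔸_L = L · con(𝔸_F)`); **(G2) `mem_range_of_commute`** — for `γ ∈ B` regular semisimple the commutant of `γ ⊗ 1` in `M_N(𝔸_L)` lies in
  `range Ψ` (★ `exists_eq_aeval_map_of_commute_of_charpoly_separable`: it consists of polynomials in `γ ⊗ 1` over `𝔸_L`);
  **(G3) `apply_map_eq_hermAdjoint`** — `Ψ ∘ (1 ⊗ τ) = ⋆_𝔸 ∘ Ψ` for `τ = ⋆|_B`, `⋆_𝔸` the adjoint over `𝔸_L` with `σ_𝔸 = σ ⊗ 1` (the tree's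
  Galois action: `AdeleRing.smul_algebraMap`, `AdeleRing.smul_baseChange`).
* §2 **`exists_commute_mul_hermAdjoint_eq_of_adelic`** (THE HEAD): `F ⊆ L` number fields, `σ ∈ Aut(L/F)` an involution `≠ 1` (as a ring map
  `σr`, on `𝔸_L` as `σA = (σ • ·)`), `H` `σ`-hermitian invertible, `γ` regular semisimple and `H`-unitary, `x ∈ Z(γ)` invertible with `x⋆ = x`,
  `c ∈ Z_{M_N(𝔸_L)}(γ ⊗ 1)` with `c c⋆ = x ⊗ 1` ⇒ `∃ b ∈ Z(γ)` invertible with `b b⋆ = x`.  Proof: `B := L[γ]` (commutative, reduced —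
  ★ `HermitianAdjointCartanAlgebra`), `τ := ⋆|_B` an `F`-involution with `τ(ε·1) = −ε·1` (`σε = −ε ≠ 0` since `σ ≠ 1`), `Ψ := lift(con, b ↦ b ⊗ 1)`;
  by (G1)–(G3) `c = Ψ(y)` with `y` a unit and `y · (1 ⊗ τ)y = 1 ⊗ x`; conclude by ★ `exists_mul_apply_eq_of_adelic`.

NOT HERE: the unitary-group reading (`Rogawski1990/RationalClassesInjectAdelically`: `U(H)(𝔸)`-conjugate ⇒ `U(H)(F)`-conjugate, composing
this head with ★ `Rogawski1990/CartanInvariant` at `R := 𝔸_L` and `R := L`).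

## References
* J. D. Rogawski, *Automorphic Representations of Unitary Groups in Three Variables*, Ann. of Math. Stud. 123 (1990), §3.5 Prop. 3.5.2 (a),
  §5.4 p. 72 [Rogawski1990].
* J. W. S. Cassels, A. Fröhlich (eds.), *Algebraic Number Theory* (1967), Ch. II §19 (19.1); Ch. VII §7.1, §9.6 [CasselsFrohlichANT1967].
* R. A. Horn, C. R. Johnson, *Matrix Analysis*, 2nd ed. (2013), Thm. 3.2.4.2 [HornJohnson2013].
-/

noncomputable section

open NumberField IsDedekindDomain Polynomial
open scoped TensorProduct Matrix
open Literature.LinearAlgebra.Matrix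

namespace Literature.NumberTheory.GaloisRepresentations

/-! ## §1 The adelic Cartan algebra: `Ψ : 𝔸_F ⊗_F B → M_N(𝔸_L)`, `r ⊗ b ↦ con(r) · (b ⊗ 1)`, for a subalgebra `B ≤ M_N(L)` -/

section Glue

open scoped NumberField.AdeleRing
open Literature.NumberTheory.AdelicBaseChange Literature.NumberTheory.Automorphic

variable {F L : Type} [Field F] [NumberField F] [Field L] [NumberField L] [Algebra F L]
  [Algebra F (AdeleRing (𝓞 L) L)] {N : ℕ} (B : Subalgebra L (Matrix (Fin N) (Fin N) L))
  (Ψ : AdeleRing (𝓞 F) F ⊗[F] ↥B →ₐ[F] Matrix (Fin N) (Fin N) (AdeleRing (𝓞 L) L))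
  (hΨ : ∀ (r : AdeleRing (𝓞 F) F) (b : ↥B),
    Ψ (r ⊗ₜ b) = NumberField.AdeleRing.baseChange F L r • (b : Matrix (Fin N) (Fin N) L).map (algebraMap L (AdeleRing (𝓞 L) L)))
include hΨ

/-- **(G1) `Ψ : 𝔸_F ⊗_F B → M_N(𝔸_L)`, `r ⊗ b ↦ con(r)·(b ⊗ 1)`, is INJECTIVE** for every `L`-subalgebra `B ≤ M_N(L)`: entrywise `Ψ` is
`𝔸_F ⊗_F B ↪ 𝔸_F ⊗_F M_N(L) = (𝔸_F ⊗_F L)^{N×N} ≅ 𝔸_L^{N×N}` (`𝔸_F` is flat over the field `F`; Cassels–Fröhlich (19.1) entry by entry).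
[cite: CasselsFrohlichANT1967, Ch. II §19 (19.1)] -/
theorem injective_of_apply_tmul : Function.Injective Ψ := by
  classical
  set ι : ↥B →ₗ[F] (Fin N → Fin N → L) :=
    (Matrix.ofLinearEquiv F).symm.toLinearMap ∘ₗ (B.val.toLinearMap.restrictScalars F) with hι
  have hιinj : Function.Injective ι := fun b b' h =>
    Subtype.ext ((Matrix.ofLinearEquiv F).symm.injective (by simpa [hι] using h))
  set Φ : AdeleRing (𝓞 F) F ⊗[F] ↥B → Fin N → Fin N → AdeleRing (𝓞 F) F ⊗[F] L := fun z p q =>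
    TensorProduct.piRight F F (AdeleRing (𝓞 F) F) (fun _ : Fin N => L)
      (TensorProduct.piRight F F (AdeleRing (𝓞 F) F) (fun _ : Fin N => Fin N → L)
        (LinearMap.lTensor (AdeleRing (𝓞 F) F) ι z) p) q with hΦ
  have hΦinj : Function.Injective Φ := by
    intro z z' h
    have h1 : LinearMap.lTensor (AdeleRing (𝓞 F) F) ι z = LinearMap.lTensor (AdeleRing (𝓞 F) F) ι z' := by
      apply (TensorProduct.piRight F F (AdeleRing (𝓞 F) F) (fun _ : Fin N => Fin N → L)).injective
      funext p
      apply (TensorProduct.piRight F F (AdeleRing (𝓞 F) F) (fun _ : Fin N => L)).injective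
      funext q
      exact congrFun (congrFun h p) q
    exact Module.Flat.lTensor_preserves_injective_linearMap ι hιinj h1
  have key : ∀ z p q, Ψ z p q = adeleRingTensorAlgEquiv F L (Φ z p q) := by
    intro z p q
    induction z using TensorProduct.induction_on with
    | zero => simp only [map_zero, hΦ, Matrix.zero_apply, Pi.zero_apply]
    | tmul r b =>
        rw [hΨ, Matrix.smul_apply, Matrix.map_apply, smul_eq_mul, hΦ]
        simp only [LinearMap.lTensor_tmul, TensorProduct.piRight_apply, TensorProduct.piRightHom_tmul,
          adeleRingTensorAlgEquiv_tmul]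
        have hιb : ι b p q = (b : Matrix (Fin N) (Fin N) L) p q := rfl
        rw [hιb, mul_comm]
    | add x y hx hy =>
        simp only [map_add, Matrix.add_apply, hx, hy, hΦ, Pi.add_apply]
  intro z z' h
  apply hΦinj
  funext p q
  apply (adeleRingTensorAlgEquiv F L).injective
  rw [← key, ← key, h]

/-- The scalar matrices `s · 1`, `s ∈ 𝔸_L`, lie in the range of `Ψ` (`𝔸_L = con(𝔸_F) · L`, Cassels–Fröhlich (19.1)).
[cite: CasselsFrohlichANT1967, Ch. II §19 (19.1)] -/
theorem smul_one_mem_range (s : AdeleRing (𝓞 L) L) : s • (1 : Matrix (Fin N) (Fin N) (AdeleRing (𝓞 L) L)) ∈ Ψ.range := by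
  obtain ⟨w, rfl⟩ := (adeleRingTensorAlgEquiv F L).surjective s
  induction w using TensorProduct.induction_on with
  | zero => rw [map_zero, zero_smul]; exact zero_mem _
  | tmul r l =>
      refine (AlgHom.mem_range Ψ).2 ⟨r ⊗ₜ ⟨l • (1 : Matrix (Fin N) (Fin N) L), B.smul_mem (one_mem B) l⟩, ?_⟩
      rw [hΨ, adeleRingTensorAlgEquiv_tmul]
      change NumberField.AdeleRing.baseChange F L r • (l • (1 : Matrix (Fin N) (Fin N) L)).map _ = _
      rw [Matrix.map_smul' _ _ _ (fun a₁ a₂ => map_mul _ a₁ a₂), Matrix.map_one _ (map_zero _) (map_one _), smul_smul,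
        mul_comm]
  | add x y hx hy => rw [map_add, add_smul]; exact add_mem hx hy

/-- **(G2) the commutant of `γ ⊗ 1` in `M_N(𝔸_L)` lies in the range of `Ψ`** when `γ ∈ B` is regular semisimple: a matrix over
`𝔸_L` commuting with `γ ⊗ 1` is a polynomial in `γ ⊗ 1` with coefficients in `𝔸_L` (Horn–Johnson 3.2.4.2 under base change, the
tree's `exists_eq_aeval_map_of_commute_of_charpoly_separable`). [cite: HornJohnson2013, Thm 3.2.4.2, p0236] -/
theorem mem_range_of_commute {γ : Matrix (Fin N) (Fin N) L} (hγB : γ ∈ B) (hreg : γ.charpoly.Separable)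
    {c : Matrix (Fin N) (Fin N) (AdeleRing (𝓞 L) L)} (hc : Commute (γ.map (algebraMap L (AdeleRing (𝓞 L) L))) c) :
    c ∈ Set.range Ψ := by
  obtain ⟨p, -, rfl⟩ := exists_eq_aeval_map_of_commute_of_charpoly_separable γ hreg c hc
  rw [← AlgHom.coe_range, SetLike.mem_coe]
  have hγ : γ.map (algebraMap L (AdeleRing (𝓞 L) L)) ∈ Ψ.range :=
    (AlgHom.mem_range Ψ).2 ⟨1 ⊗ₜ ⟨γ, hγB⟩, by rw [hΨ, map_one, one_smul]⟩
  rw [aeval_eq_sum_range]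
  refine Subalgebra.sum_mem _ fun i _ => ?_
  rw [← smul_one_mul]
  exact mul_mem (smul_one_mem_range B Ψ hΨ _) (pow_mem hγ i)


/-- **(G3) `Ψ` intertwines `1 ⊗ τ` with the adelic adjoint**: for an `F`-automorphism `τ` of `B` acting by `b ↦ b⋆ = H⁻¹ ᵗ(σb) H`,
`Ψ ((1 ⊗ τ) z) = (Ψ z)⋆` with the adjoint over `𝔸_L` formed with `σ_𝔸 = σ ⊗ 1` (the Galois action `σ • ·` of the tree, which fixes
`con(𝔸_F)`: `AdeleRing.smul_baseChange`, and extends `σ`: `AdeleRing.smul_algebraMap`). [cite: CasselsFrohlichANT1967, Ch. VII §7.1] -/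
theorem apply_map_eq_hermAdjoint (σ : L ≃ₐ[F] L) (σr : L →+* L) (hσr : ∀ x, σr x = σ x)
    (σA : AdeleRing (𝓞 L) L →+* AdeleRing (𝓞 L) L) (hσA : ∀ z, σA z = σ • z) {H : Matrix (Fin N) (Fin N) L} (hHdet : IsUnit H.det)
    (τ : ↥B ≃ₐ[F] ↥B) (hτ : ∀ b : ↥B, ((τ b : ↥B) : Matrix (Fin N) (Fin N) L) = H⁻¹ * ((b : Matrix (Fin N) (Fin N) L).map σr)ᵀ * H)
    (z : AdeleRing (𝓞 F) F ⊗[F] ↥B) :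
    Ψ (Algebra.TensorProduct.map (AlgHom.id (AdeleRing (𝓞 F) F) (AdeleRing (𝓞 F) F)) (τ : ↥B →ₐ[F] ↥B) z) =
      (H.map (algebraMap L (AdeleRing (𝓞 L) L)))⁻¹ * ((Ψ z).map σA)ᵀ * H.map (algebraMap L (AdeleRing (𝓞 L) L)) := by
  have hf : ∀ x : L, algebraMap L (AdeleRing (𝓞 L) L) (σr x) = σA (algebraMap L (AdeleRing (𝓞 L) L) x) := fun x => by
    rw [hσr, hσA, AdeleRing.smul_algebraMap]
  induction z using TensorProduct.induction_on with
  | zero =>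
      rw [map_zero, map_zero, Matrix.map_zero σA (map_zero σA), Matrix.transpose_zero, Matrix.mul_zero, Matrix.zero_mul]
  | tmul r b =>
      rw [Algebra.TensorProduct.map_tmul]
      change Ψ (r ⊗ₜ τ b) = _
      rw [hΨ, hΨ, hτ, map_hermAdjoint σr σA (algebraMap L (AdeleRing (𝓞 L) L)) hf hHdet, hermAdjoint_smul σA,
        adeleRing_baseChange_apply_eq, hσA, AdeleRing.smul_baseChange]
  | add x y hx hy =>
      rw [map_add, map_add, hx, hy, map_add, hermAdjoint_add]

end Glue

/-! ## §2 The head: Hasse's norm principle for the commutant of a regular unitary matrix, adelic form -/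

section Main

open scoped NumberField.AdeleRing IsMulCommutative
open Literature.NumberTheory.AdelicBaseChange Literature.NumberTheory.Automorphic

/-- **Hasse's norm principle for the Cartan algebra of a regular unitary element, adelic form (matrix dress).**  Let `F ⊆ L` be number
fields with an `F`-involution `σ ≠ 1` of `L` (`σr = σ` as a ring map, `σ_𝔸 = σ ⊗ 1` its action on `𝔸_L`), `H` an invertible `σ`-hermitian
matrix, `X⋆ := H⁻¹ ᵗ(σX) H` the adjoint, `γ ∈ M_N(L)` REGULAR SEMISIMPLE (separable characteristic polynomial) and `H`-UNITARY (`ᵗ(σγ) H γ = H`),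
and `x ∈ Z(γ)` invertible with `x⋆ = x`.  If `x ⊗ 1 = c · c⋆` for some `c ∈ M_N(𝔸_L)` commuting with `γ ⊗ 1` — the class of `x` in
`(Z(γ)^⋆)ˣ ∕ N(Z_{𝔸}(γ)ˣ)` is trivial ADELICALLY — then `x = b · b⋆` for an invertible `b ∈ Z(γ) ⊂ M_N(L)`: the class is trivial RATIONALLY.
This is `Ш¹(F, T_γ) = 1` for the maximal torus `T_γ = Z_{U(H)}(γ)` («`k(γ₀) = 1`»): with the Cartan invariant `c(γ, δ) = g g⋆` it says that two
elements of `U(H)(F)` in one regular stable class which are `U(H)(𝔸_F)`-conjugate are `U(H)(F)`-conjugate.  Proof: `B := L[γ] = Z(γ)` is a finite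
reduced `F`-algebra with the involution `τ = ⋆|_B` and `τ(ε·1) = −ε·1` (`σε = −ε ≠ 0`); `Ψ : 𝔸_F ⊗_F B → M_N(𝔸_L)` is injective with range
`⊇ Z(γ ⊗ 1) ∋ c, c⁻¹ = c⋆ (x ⊗ 1)⁻¹` and intertwines `1 ⊗ τ` with `⋆` (§1), so `c = Ψ(y)` with `y` a unit and `y · (1 ⊗ τ)y = 1 ⊗ x`; conclude by
★ `exists_mul_apply_eq_of_adelic` (Hasse for `(B, τ)`). [cite: Rogawski1990, §3.5 Prop. 3.5.2 (a), §5.4 p. 72]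
[cite: CasselsFrohlichANT1967, Ch. VII §9.6 (Hasse norm theorem)] -/
theorem exists_commute_mul_hermAdjoint_eq_of_adelic {F L : Type} [Field F] [NumberField F] [Field L] [NumberField L] [Algebra F L]
    (σ : L ≃ₐ[F] L) (hσ : σ * σ = 1) (hσ1 : σ ≠ 1) (σr : L →+* L) (hσr : ∀ x, σr x = σ x)
    (σA : AdeleRing (𝓞 L) L →+* AdeleRing (𝓞 L) L) (hσA : ∀ z, σA z = σ • z)
    {N : ℕ} {H : Matrix (Fin N) (Fin N) L} (hHdet : IsUnit H.det) (hH : (H.map σr)ᵀ = H)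
    {γ : Matrix (Fin N) (Fin N) L} (hreg : γ.charpoly.Separable) (hγ : (γ.map σr)ᵀ * H * γ = H)
    {x : Matrix (Fin N) (Fin N) L} (hxγ : Commute x γ) (hxs : H⁻¹ * (x.map σr)ᵀ * H = x) (hxu : IsUnit x.det)
    {c : Matrix (Fin N) (Fin N) (AdeleRing (𝓞 L) L)} (hcγ : Commute c (γ.map (algebraMap L (AdeleRing (𝓞 L) L))))
    (hc : c * ((H.map (algebraMap L (AdeleRing (𝓞 L) L)))⁻¹ * (c.map σA)ᵀ * H.map (algebraMap L (AdeleRing (𝓞 L) L))) =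
      x.map (algebraMap L (AdeleRing (𝓞 L) L))) :
    ∃ b : Matrix (Fin N) (Fin N) L, Commute b γ ∧ IsUnit b.det ∧ b * (H⁻¹ * (b.map σr)ᵀ * H) = x := by
  classical
  have hσσ : ∀ r, σr (σr r) = r := fun r => by rw [hσr, hσr, ← AlgEquiv.mul_apply, hσ, AlgEquiv.one_apply]
  -- §A the Cartan algebra `B = L[γ]`: commutative, reduced, finite over `F`
  haveI : IsMulCommutative ↥(Algebra.adjoin L ({γ} : Set (Matrix (Fin N) (Fin N) L))) :=
    Algebra.isMulCommutative_adjoin L (by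
      intro a ha b hb; rw [Set.mem_singleton_iff.1 ha, Set.mem_singleton_iff.1 hb])
  set B : Subalgebra L (Matrix (Fin N) (Fin N) L) := Algebra.adjoin L ({γ} : Set (Matrix (Fin N) (Fin N) L)) with hB
  haveI : IsReduced ↥B := isReduced_adjoin_singleton γ hreg
  haveI : Module.Finite F ↥B := Module.Finite.trans L ↥B
  have hBcomm : ∀ a b : ↥B, a * b = b * a := fun a b => mul_comm a b
  -- §B the involution `τ = ⋆|_B`
  have hmemτ : ∀ b : ↥B, H⁻¹ * ((b : Matrix (Fin N) (Fin N) L).map σr)ᵀ * H ∈ B := fun b =>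
    hermAdjoint_mem_adjoin_singleton γ hreg σr hHdet hγ b.2
  let τh : ↥B →ₐ[F] ↥B :=
    { toFun := fun b => ⟨H⁻¹ * ((b : Matrix (Fin N) (Fin N) L).map σr)ᵀ * H, hmemτ b⟩
      map_one' := Subtype.ext (hermAdjoint_one σr hHdet)
      map_mul' := fun a b => Subtype.ext (by
        change H⁻¹ * (((a : Matrix (Fin N) (Fin N) L) * b).map σr)ᵀ * H =
          H⁻¹ * ((a : Matrix (Fin N) (Fin N) L).map σr)ᵀ * H * (H⁻¹ * ((b : Matrix (Fin N) (Fin N) L).map σr)ᵀ * H)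
        rw [hermAdjoint_mul σr hHdet]
        exact congrArg Subtype.val (hBcomm ⟨_, hmemτ b⟩ ⟨_, hmemτ a⟩))
      map_zero' := Subtype.ext (by
        change H⁻¹ * ((0 : Matrix (Fin N) (Fin N) L).map σr)ᵀ * H = 0
        rw [Matrix.map_zero σr (map_zero σr), Matrix.transpose_zero, Matrix.mul_zero, Matrix.zero_mul])
      map_add' := fun a b => Subtype.ext (hermAdjoint_add σr H _ _)
      commutes' := fun q => Subtype.ext (by
        change H⁻¹ * ((algebraMap F (Matrix (Fin N) (Fin N) L) q).map σr)ᵀ * H = algebraMap F (Matrix (Fin N) (Fin N) L) q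
        rw [Algebra.algebraMap_eq_smul_one, ← algebraMap_smul L q (1 : Matrix (Fin N) (Fin N) L), hermAdjoint_smul σr H,
          hermAdjoint_one σr hHdet, hσr, AlgEquiv.commutes]) }
  have hτh : ∀ b : ↥B, ((τh b : ↥B) : Matrix (Fin N) (Fin N) L) = H⁻¹ * ((b : Matrix (Fin N) (Fin N) L).map σr)ᵀ * H :=
    fun b => rfl
  have hτhτh : ∀ b : ↥B, τh (τh b) = b := fun b =>
    Subtype.ext (by rw [hτh, hτh, hermAdjoint_hermAdjoint σr hσσ hH hHdet])
  let τ : ↥B ≃ₐ[F] ↥B := AlgEquiv.ofAlgHom τh τh (AlgHom.ext hτhτh) (AlgHom.ext hτhτh)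
  have hτ : ∀ b : ↥B, ((τ b : ↥B) : Matrix (Fin N) (Fin N) L) = H⁻¹ * ((b : Matrix (Fin N) (Fin N) L).map σr)ᵀ * H :=
    fun b => rfl
  have hτ2 : ∀ b : ↥B, τ (τ b) = b := hτhτh
  -- §C the anti-fixed unit `θ = ε · 1`, `σ ε = -ε`
  obtain ⟨ℓ, hℓ⟩ : ∃ ℓ : L, σ ℓ ≠ ℓ := by
    by_contra h
    exact hσ1 (AlgEquiv.ext fun ℓ => not_not.1 (not_exists.1 h ℓ))
  set ε : L := ℓ - σ ℓ with hε
  have hε0 : ε ≠ 0 := sub_ne_zero.2 (Ne.symm hℓ)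
  have hσε : σr ε = -ε := by
    rw [hσr, hε, map_sub, ← AlgEquiv.mul_apply, hσ, AlgEquiv.one_apply, neg_sub]
  have hθval : (ε • (1 : Matrix (Fin N) (Fin N) L)) * (ε⁻¹ • (1 : Matrix (Fin N) (Fin N) L)) = 1 := by
    rw [smul_mul_smul_comm, Matrix.mul_one, mul_inv_cancel₀ hε0, one_smul]
  let θ : (↥B)ˣ :=
    ⟨⟨ε • 1, B.smul_mem (one_mem B) ε⟩, ⟨ε⁻¹ • 1, B.smul_mem (one_mem B) ε⁻¹⟩, Subtype.ext hθval,
      (hBcomm _ _).trans (Subtype.ext hθval)⟩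
  have hθ : τ θ = -θ := Subtype.ext (by
    change H⁻¹ * ((ε • (1 : Matrix (Fin N) (Fin N) L)).map σr)ᵀ * H = -(ε • (1 : Matrix (Fin N) (Fin N) L))
    rw [hermAdjoint_smul σr H, hermAdjoint_one σr hHdet, hσε, neg_smul])
  -- §D the symmetric unit `a = x`
  have hxB : x ∈ B := mem_adjoin_singleton_of_commute γ hreg hxγ.symm
  have hxinvγ : Commute x⁻¹ γ := by
    have h1 : x⁻¹ * γ = x⁻¹ * γ * (x * x⁻¹) := by rw [Matrix.mul_nonsing_inv x hxu, Matrix.mul_one]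
    calc x⁻¹ * γ = x⁻¹ * (γ * x) * x⁻¹ := by rw [h1]; simp only [Matrix.mul_assoc]
      _ = x⁻¹ * (x * γ) * x⁻¹ := by rw [hxγ.eq]
      _ = γ * x⁻¹ := by rw [← Matrix.mul_assoc, Matrix.nonsing_inv_mul x hxu, Matrix.one_mul]
  have hxinvB : x⁻¹ ∈ B := mem_adjoin_singleton_of_commute γ hreg hxinvγ.symm
  let a : (↥B)ˣ := ⟨⟨x, hxB⟩, ⟨x⁻¹, hxinvB⟩, Subtype.ext (Matrix.mul_nonsing_inv x hxu), Subtype.ext (Matrix.nonsing_inv_mul x hxu)⟩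
  have ha : τ a = a := Subtype.ext hxs
  -- §E the adelic Cartan algebra `Ψ : 𝔸_F ⊗ B → M_N(𝔸_L)`
  letI instFA : Algebra F (AdeleRing (𝓞 L) L) := ((algebraMap L (AdeleRing (𝓞 L) L)).comp (algebraMap F L)).toAlgebra
  haveI : IsScalarTower F L (AdeleRing (𝓞 L) L) := IsScalarTower.of_algebraMap_eq (fun q => rfl)
  let f : AdeleRing (𝓞 F) F →ₐ[F] Matrix (Fin N) (Fin N) (AdeleRing (𝓞 L) L) :=
    { toRingHom := (algebraMap (AdeleRing (𝓞 L) L) (Matrix (Fin N) (Fin N) (AdeleRing (𝓞 L) L))).comp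
        (Literature.NumberTheory.Automorphic.AdeleRing.baseChange F L)
      commutes' := fun q => by
        change algebraMap (AdeleRing (𝓞 L) L) (Matrix (Fin N) (Fin N) (AdeleRing (𝓞 L) L))
            (Literature.NumberTheory.Automorphic.AdeleRing.baseChange F L (algebraMap F (AdeleRing (𝓞 F) F) q)) =
          algebraMap F _ q
        rw [Literature.NumberTheory.Automorphic.AdeleRing.baseChange_algebraMap,
          IsScalarTower.algebraMap_apply F (AdeleRing (𝓞 L) L) (Matrix (Fin N) (Fin N) _) q]
        rfl }
  let g : ↥B →ₐ[F] Matrix (Fin N) (Fin N) (AdeleRing (𝓞 L) L) :=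
    (((Algebra.ofId L (AdeleRing (𝓞 L) L)).mapMatrix.comp B.val).restrictScalars F)
  have hg : ∀ b : ↥B, g b = (b : Matrix (Fin N) (Fin N) L).map (algebraMap L (AdeleRing (𝓞 L) L)) := fun b => rfl
  have hfg : ∀ r b, Commute (f r) (g b) := fun r b => Algebra.commutes _ _
  set Ψ : AdeleRing (𝓞 F) F ⊗[F] ↥B →ₐ[F] Matrix (Fin N) (Fin N) (AdeleRing (𝓞 L) L) := Algebra.TensorProduct.lift f g hfg with hΨdef
  have hΨ : ∀ (r : AdeleRing (𝓞 F) F) (b : ↥B), Ψ (r ⊗ₜ b) =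
      NumberField.AdeleRing.baseChange F L r • (b : Matrix (Fin N) (Fin N) L).map (algebraMap L (AdeleRing (𝓞 L) L)) := by
    intro r b
    rw [hΨdef, Algebra.TensorProduct.lift_tmul, hg, adeleRing_baseChange_apply_eq]
    change algebraMap (AdeleRing (𝓞 L) L) (Matrix (Fin N) (Fin N) (AdeleRing (𝓞 L) L))
        (Literature.NumberTheory.Automorphic.AdeleRing.baseChange F L r) * _ = _
    rw [← Algebra.smul_def]
  -- §F `c = Ψ y` with `y` a unit and `y · (1 ⊗ τ) y = 1 ⊗ a`
  set alg := algebraMap L (AdeleRing (𝓞 L) L) with halg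
  have hf' : ∀ r : L, alg (σr r) = σA (alg r) := fun r => by rw [hσr, hσA, halg, AdeleRing.smul_algebraMap]
  have hcomp : (⇑alg ∘ ⇑σr : L → AdeleRing (𝓞 L) L) = ⇑σA ∘ ⇑alg := funext fun r => hf' r
  have hHA : IsUnit (H.map alg).det := by
    rw [← RingHom.mapMatrix_apply, ← RingHom.map_det]; exact hHdet.map _
  have hγA : ((γ.map alg).map σA)ᵀ * H.map alg * γ.map alg = H.map alg := by
    have h := congrArg (fun M : Matrix (Fin N) (Fin N) L => M.map alg) hγ
    simp only [Matrix.map_mul] at h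
    rwa [← Matrix.transpose_map, Matrix.map_map, hcomp, ← Matrix.map_map, Matrix.transpose_map] at h
  -- the inverse `c' = c⋆ · (x⁻¹ ⊗ 1)` of `c` inside the commutant of `γ ⊗ 1`
  set cs := (H.map alg)⁻¹ * (c.map σA)ᵀ * H.map alg with hcs
  have hcsγ : Commute cs (γ.map alg) := (commute_hermAdjoint_of_commute σA hHA hγA hcγ.symm).symm
  set xiA := x⁻¹.map alg with hxiA
  have hxxiA : x.map alg * xiA = 1 := by
    rw [hxiA, ← Matrix.map_mul, Matrix.mul_nonsing_inv x hxu, Matrix.map_one alg (map_zero alg) (map_one alg)]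
  have hxiAγ : Commute xiA (γ.map alg) := by
    change xiA * γ.map alg = γ.map alg * xiA
    rw [hxiA, ← Matrix.map_mul, hxinvγ.eq, Matrix.map_mul]
  have hcc' : c * (cs * xiA) = 1 := by rw [← Matrix.mul_assoc, hc, hxxiA]
  have hc'γ : Commute (cs * xiA) (γ.map alg) := hcsγ.mul_left hxiAγ
  -- preimages under `Ψ`
  have hγB : γ ∈ B := Algebra.self_mem_adjoin_singleton L γ
  obtain ⟨y, hy⟩ := mem_range_of_commute B Ψ hΨ hγB hreg hcγ.symm
  obtain ⟨y', hy'⟩ := mem_range_of_commute B Ψ hΨ hγB hreg hc'γ.symm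
  have hinj := injective_of_apply_tmul B Ψ hΨ
  have hyy' : y * y' = 1 := hinj (by rw [map_mul, hy, hy', hcc', map_one])
  let yu : (AdeleRing (𝓞 F) F ⊗[F] ↥B)ˣ := ⟨y, y', hyy', (mul_comm y' y).trans hyy'⟩
  have hyτ : (yu : AdeleRing (𝓞 F) F ⊗[F] ↥B) *
      Algebra.TensorProduct.map (AlgHom.id (AdeleRing (𝓞 F) F) (AdeleRing (𝓞 F) F)) (τ : ↥B →ₐ[F] ↥B) yu =
        1 ⊗ₜ ((a : ↥B) : ↥B) := by
    apply hinj
    rw [map_mul, apply_map_eq_hermAdjoint B Ψ hΨ σ σr hσr σA hσA hHdet τ hτ, hΨ, map_one, one_smul]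
    change Ψ y * ((H.map alg)⁻¹ * ((Ψ y).map σA)ᵀ * H.map alg) = x.map alg
    rw [hy]
    exact hc
  -- §G Hasse for `(B, τ)`
  obtain ⟨b, hb⟩ := exists_mul_apply_eq_of_adelic τ hτ2 θ hθ a ha yu hyτ
  refine ⟨((b : ↥B) : Matrix (Fin N) (Fin N) L), commute_of_mem_adjoin_singleton (b : ↥B).2, ?_, ?_⟩
  · exact Matrix.isUnit_det_of_right_inverse (B := (((b⁻¹ : (↥B)ˣ) : ↥B) : Matrix (Fin N) (Fin N) L))
      (by rw [← Subalgebra.coe_mul, ← Units.val_mul, mul_inv_cancel, Units.val_one, Subalgebra.coe_one])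
  · have h := congrArg Subtype.val hb
    rw [Subalgebra.coe_mul, hτ] at h
    exact h

/-- **The head in the NORM shape of ★ `Rogawski1990/CartanAlgebra.exists_unitary_conj_iff_exists_norm_eq`** (`δ ∼ γ ↔ ∃ t ∈ Z(γ)ˣ,
`x · (t⋆ t) = 1`): if the norm equation `x · (t⋆ t) = 1` has a solution `t` in the commutant of `γ ⊗ 1` in `M_N(𝔸_L)` (conjugacy in `U(H)(𝔸_F)`),
it has a solution `t₀` in the commutant of `γ` in `M_N(L)` (conjugacy in `U(H)(F)`) — same hypotheses on `σ, H, γ, x` as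
`exists_commute_mul_hermAdjoint_eq_of_adelic`; `c := t⁻¹` has `c c⋆ = (t⋆ t)⁻¹ = x ⊗ 1`, and `t₀ := b⁻¹` for the resulting `b` with `b b⋆ = x`
(only the anti-multiplicativity of `⋆` is used). [cite: Rogawski1990, §3.5 Prop. 3.5.2 (a), §5.4 p. 72] -/
theorem exists_commute_mul_norm_eq_one_of_adelic {F L : Type} [Field F] [NumberField F] [Field L] [NumberField L] [Algebra F L]
    (σ : L ≃ₐ[F] L) (hσ : σ * σ = 1) (hσ1 : σ ≠ 1) (σr : L →+* L) (hσr : ∀ x, σr x = σ x)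
    (σA : AdeleRing (𝓞 L) L →+* AdeleRing (𝓞 L) L) (hσA : ∀ z, σA z = σ • z)
    {N : ℕ} {H : Matrix (Fin N) (Fin N) L} (hHdet : IsUnit H.det) (hH : (H.map σr)ᵀ = H)
    {γ : Matrix (Fin N) (Fin N) L} (hreg : γ.charpoly.Separable) (hγ : (γ.map σr)ᵀ * H * γ = H)
    {x : Matrix (Fin N) (Fin N) L} (hxγ : Commute x γ) (hxs : H⁻¹ * (x.map σr)ᵀ * H = x) (hxu : IsUnit x.det)
    {t : Matrix (Fin N) (Fin N) (AdeleRing (𝓞 L) L)} (htγ : Commute t (γ.map (algebraMap L (AdeleRing (𝓞 L) L)))) (htu : IsUnit t.det)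
    (ht : x.map (algebraMap L (AdeleRing (𝓞 L) L)) *
      ((H.map (algebraMap L (AdeleRing (𝓞 L) L)))⁻¹ * (t.map σA)ᵀ * H.map (algebraMap L (AdeleRing (𝓞 L) L)) * t) = 1) :
    ∃ t₀ : Matrix (Fin N) (Fin N) L, Commute t₀ γ ∧ IsUnit t₀.det ∧ x * (H⁻¹ * (t₀.map σr)ᵀ * H * t₀) = 1 := by
  set alg := algebraMap L (AdeleRing (𝓞 L) L) with halg
  have hHA : IsUnit (H.map alg).det := by
    rw [← RingHom.mapMatrix_apply, ← RingHom.map_det]; exact hHdet.map _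
  -- `c := t⁻¹` commutes with `γ ⊗ 1` and `c c⋆` is a right inverse of `t⋆ t`, hence equals its left inverse `x ⊗ 1`
  have hcγ : Commute t⁻¹ (γ.map alg) := (nonsing_inv_mul_eq_mul_nonsing_inv_of_commute htu htγ.symm)
  have hright : (H.map alg)⁻¹ * (t.map σA)ᵀ * H.map alg * t * (t⁻¹ * ((H.map alg)⁻¹ * (t⁻¹.map σA)ᵀ * H.map alg)) = 1 := by
    calc (H.map alg)⁻¹ * (t.map σA)ᵀ * H.map alg * t * (t⁻¹ * ((H.map alg)⁻¹ * (t⁻¹.map σA)ᵀ * H.map alg))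
        = (H.map alg)⁻¹ * (t.map σA)ᵀ * H.map alg * (t * t⁻¹) * ((H.map alg)⁻¹ * (t⁻¹.map σA)ᵀ * H.map alg) := by
          simp only [Matrix.mul_assoc]
      _ = (H.map alg)⁻¹ * ((t⁻¹ * t).map σA)ᵀ * H.map alg := by
          rw [Matrix.mul_nonsing_inv t htu, Matrix.mul_one, hermAdjoint_mul σA hHA]
      _ = 1 := by rw [Matrix.nonsing_inv_mul t htu, hermAdjoint_one σA hHA]
  have hc : t⁻¹ * ((H.map alg)⁻¹ * (t⁻¹.map σA)ᵀ * H.map alg) = x.map alg := by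
    calc t⁻¹ * ((H.map alg)⁻¹ * (t⁻¹.map σA)ᵀ * H.map alg)
        = x.map alg * ((H.map alg)⁻¹ * (t.map σA)ᵀ * H.map alg * t) * (t⁻¹ * ((H.map alg)⁻¹ * (t⁻¹.map σA)ᵀ * H.map alg)) := by
          rw [ht, Matrix.one_mul]
      _ = x.map alg := by rw [Matrix.mul_assoc, hright, Matrix.mul_one]
  obtain ⟨b, hbγ, hbu, hb⟩ := exists_commute_mul_hermAdjoint_eq_of_adelic σ hσ hσ1 σr hσr σA hσA hHdet hH hreg hγ hxγ hxs hxu hcγ hc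
  -- `t₀ := b⁻¹`
  refine ⟨b⁻¹, nonsing_inv_mul_eq_mul_nonsing_inv_of_commute hbu hbγ.symm, Matrix.isUnit_nonsing_inv_det b hbu, ?_⟩
  calc x * (H⁻¹ * (b⁻¹.map σr)ᵀ * H * b⁻¹) = b * (H⁻¹ * (b.map σr)ᵀ * H) * (H⁻¹ * (b⁻¹.map σr)ᵀ * H * b⁻¹) := by rw [hb]
    _ = b * (H⁻¹ * (b.map σr)ᵀ * H * (H⁻¹ * (b⁻¹.map σr)ᵀ * H)) * b⁻¹ := by simp only [Matrix.mul_assoc]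
    _ = b * (H⁻¹ * ((b⁻¹ * b).map σr)ᵀ * H) * b⁻¹ := by rw [hermAdjoint_mul σr hHdet]
    _ = 1 := by rw [Matrix.nonsing_inv_mul b hbu, hermAdjoint_one σr hHdet, Matrix.mul_one, Matrix.mul_nonsing_inv b hbu]

end Main

end Literature.NumberTheory.GaloisRepresentations
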